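import Summits.BirchSwinnertonDyer.BirchSwinnertonDyer.Theorems.PrintCFramBottomClassIndexLawFiveLeSelmerCountCaseS
import Summits.BirchSwinnertonDyer.BirchSwinnertonDyer.Theorems.PrintCFramBottomClassIndexLawFiveLeSelmerCountClassSidePRank
import Summits.BirchSwinnertonDyer.BirchSwinnertonDyer.Theorems.PrintCFramBottomClassIndexLawFiveLeLevelDictionaryBetaAvatar
import HarnessLib

/-!
# Route `PrintCFram`, crux C2 `BottomClassIndexLawFiveLe` (stmt-BirchSwinnertonDyer-20372), line
# `eisenstein-resource-bdp-line` (registry v19, stub B1 `stub_bsdp_of_classFactor`): **THE SELMER COUNT ON THE CLASS, CASE S, p-RANK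
# FORM, MAZUR–WILES-FREE** — «CASE S ∧ every abelian realisation of `ψ` has a CYCLIC class-group component ⟹ `#Sel_p(W/ℚ) ≤ p²`»,
# hence (parity split) `Ш(W)[p] = 0` and `BSD_p(W) ⟺ p ∤ #Ш_an(W)` there — for EVERY value of `v_p(B_{1,ψ⁻¹})`
# (cell `bsd-print-cfram`, width seat `bsd-line-cfram-p1-w4` g10; helper `--supports` 20372; 0 defs, 0 facts, 0 sorry;
# the `BSD_p` corollaries are CONDITIONAL on Cassels–Tate (`hCT`) and GZK, as in w2 g9's file)

HONEST FRAMING. Nothing about BSD is proved unconditionally here and no stub is closed; B1 is NOT proved. This is the `p`-RANK form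
of w2 g9's `SelmerCount.natCard_selmerGroup_le_sq_of_caseS` (p676290; seat w7 g3's successor item (ii), HOME/HANDOFF §line-cfram-p1-w7 g3
addendum): the two hypotheses «`‖B_{1,ψ⁻¹}‖_p = p⁻¹`» and Mazur–Wiles Thm 2 (`hMW`) are REPLACED by ONE class-group hypothesis with NO
`L`-value in it —

  `hrank N`: for every number field `L` ABELIAN over `ℚ` with `p ∤ [L:ℚ]` and every `χ : Gal(L/ℚ) →* ℤ_pˣ` realising `ψ`
  (`χ(τ̄) = ψ(χ_f τ)` in `ℚ_p` for all `τ ∈ Γ_ℚ`), the `p`-torsion of `e_χ(ℤ_p ⊗ Cl(𝓞 L))` has at most `N` elements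

— and the conclusion is `#Sel_p(W/ℚ) ≤ N²`. With `N = p` («the `ψ`-components are CYCLIC», `p`-rank `≤ 1`) the parity-split corollaries
of w2 g8 / w3 g8 apply verbatim. Under Mazur–Wiles, `‖B_{1,ψ⁻¹}‖_p = p^{−v}` gives `hrank (p^v)` (`chiTorsion_le_pow_of_mazurWiles`), so
`v = 1` recovers p676290; but `hrank p` also holds whenever the `ψ`-part of the class group is cyclic of ANY order `p^v` — those B1
members (CASE S, `v ≥ 2`, cyclic) were «first-order-undecided» in the seat notes w2g9 §3 / w7g3 §2 and are now in the small-Selmer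
branch: `Ш(W)[p] = 0` and `BSD_p(W) ⟺ p ∤ #Ш_an(W)` (⟺ Heegner `p`-primitivity, w3 g8/g9).
Pieces: `exists_rationalLineData_of_hss` (w6 g3), `LevelDictionaryBeta.apply_modNCyclotomicCharacter_eq_teich_sub/_quot` (w5 g3),
w2 g9's `natCard_selmerGroup_le_of_transverse/_aligned`, this seat's MW-free class side (`SelmerCountClassSide.…_of_chiTorsion_le`).

* **`natCard_selmerGroup_le_sq_of_caseS_of_chiTorsion_le`** — class member, odd datum `(f,ψ,ω)` + `hss`, `hrank N`, CASE S ⊢ `#Sel_p(W/ℚ) ≤ N²`.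
* `chiTorsion_le_pow_of_mazurWiles` — `hMW`, `ψ` odd, `‖B_{1,ψ⁻¹}‖_p = p^{−v}` ⊢ `hrank (p^v)` (the dictionary back to p676290).
* `sha_noPTorsion_of_caseS_of_chiTorsion_le`, `bsdp_iff_shaAnUnit_of_caseS_of_chiTorsion_le`, `bsdp_of_caseS_of_chiTorsion_le_of_shaAnUnit`,
  `bsdp_of_sha_ne_zero_of_caseS_of_chiTorsion_le` — the parity-split corollaries at `N = p` (mod `hCT`, `hGZK`, `r_an = 1`).

THEOREMS ONLY; no definition, no named fact, no `sorry`. BSD is not proved by any of this; no summit statement is proved by this seat.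
References: [SilvermanAEC2009] X.§4; [Washington1997] §6.3, §10.2; [Cassels1962ArithmeticIV]; [GreenbergLNM1716] §3; [MazurWiles1984] Thm. 2; notes w2g9, w7g3.
-/

set_option autoImplicit false
-- `…BirchSwinnertonDyer.BirchSwinnertonDyer.Theorems…` is the problem's mandated namespace (D-0017).
set_option linter.dupNamespace false

noncomputable section

open scoped Classical Pointwise

namespace Summit.BirchSwinnertonDyer.BirchSwinnertonDyer.Theorems.PrintCFram.SelmerCount

open NumberField IsDedekindDomain Field WeierstrassCurve DirichletCharacter
open Literature.NumberTheory.NumberFields Literature.NumberTheory.EllipticCurves Literature.NumberTheory.GaloisRepresentations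
  Literature.NumberTheory.EllipticCurves.Rank1Residual Literature.NumberTheory.EllipticCurves.KrizLi2019
  Literature.NumberTheory.EllipticCurves.GreenbergSelmer
open Summit.BirchSwinnertonDyer.Rank1Residual Summit.BirchSwinnertonDyer.Rank1Residual.X2.ResidualDevissageModules
open Summit.BirchSwinnertonDyer.BirchSwinnertonDyer.Theorems.PrintCFram.HerbrandSelmerToHom
open Summit.BirchSwinnertonDyer.BirchSwinnertonDyer.Theorems.PrintCFram.LevelDictionaryAlpha
open Summit.BirchSwinnertonDyer.BirchSwinnertonDyer.Theorems.PrintCFram.HerbrandCountPRank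

variable {p : ℕ} [hp : Fact p.Prime]

/-! ## §1 The dictionary back to Mazur–Wiles: `‖B_{1,ψ⁻¹}‖_p = p^{−v}` gives `hrank (p^v)` -/

/-- **Under Mazur–Wiles, every abelian realisation of an odd `ψ` has a class-group component of ORDER `p^{v_p(B_{1,ψ⁻¹})}`, hence of
`p`-torsion `≤ p^v`.** `L/ℚ` abelian, `p` odd, `p ∤ [L:ℚ]`, `ψ` odd (any level `f`) with `‖B_{1,ψ⁻¹}‖_p = p^{−v}`, `χ : Gal(L/ℚ) →* ℤ_pˣ`
with `χ(τ̄) = ψ(χ_f τ)`: `#(e_χ(ℤ_p ⊗ Cl(𝓞 L)))[p] ≤ p^v` (through the primitive character of `ψ` and w7 g3's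
`HerbrandReflectionCount.classGroupChiCard_eq_pow_of_norm_bernoulli_eq`). At `v = 1` this is the hypothesis `hrank p` of §2, so
p676290 is the `v = 1` instance of the `p`-rank form. [cite: MazurWiles1984, Thm. 2 (p. 216) — via Solomon1990, §I p. 468]
[cite: Washington1997, §6.3] -/
theorem chiTorsion_le_pow_of_mazurWiles (hMW : MazurWiles1984.thm2_card_oddChiClassGroup_eq_bernoulli) (hp2 : p ≠ 2)
    {L : Type} [Field L] [NumberField L] [IsAbelianGalois ℚ L] (hpL : ¬ p ∣ Module.finrank ℚ L)
    {f : ℕ} [NeZero f] (ψ : DirichletCharacter ℚ_[p] f) (hψ : ψ.Odd) {v : ℕ} (hB : ‖bernoulliOnePrim ψ⁻¹‖ = ((p : ℝ) ^ v)⁻¹)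
    (χ : (L ≃ₐ[ℚ] L) →* ℤ_[p]ˣ)
    (hχ : ∀ τ : absoluteGaloisGroup ℚ, (((χ (absGaloisQuot ℚ L τ) : ℤ_[p]ˣ) : ℤ_[p]) : ℚ_[p]) =
      ψ ((modNCyclotomicCharacter ℚ f τ : (ZMod f)ˣ) : ZMod f)) :
    Nat.card {y : ↥(classGroupChiComponent ℚ L p (fun g => ((χ g : ℤ_[p]ˣ) : ℤ_[p]))) // p • y = 0} ≤ p ^ v := by
  haveI : NeZero ψ.conductor := ⟨ψ.conductor_ne_zero⟩
  have hdvd := ψ.conductor_dvd_level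
  have hprim : ψ.primitiveCharacter.IsPrimitive := primitiveCharacter_isPrimitive ψ
  have hodd' : ψ.primitiveCharacter.Odd := (BernoulliUnits.primitiveCharacter_odd_iff ψ).mpr hψ
  have hψχ : ∀ τ : absoluteGaloisGroup ℚ, (((χ (absGaloisQuot ℚ L τ) : ℤ_[p]ˣ) : ℤ_[p]) : ℚ_[p]) =
      ψ.primitiveCharacter ((modNCyclotomicCharacter ℚ ψ.conductor τ : (ZMod ψ.conductor)ˣ) : ZMod ψ.conductor) :=
    fun τ => by rw [hχ τ, BernoulliUnits.primitiveCharacter_apply_modNCyclotomicCharacter ψ τ]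
  have hB' : ‖bernoulliOnePrim ψ.primitiveCharacter⁻¹‖ = ((p : ℝ) ^ v)⁻¹ := by
    rw [← RegularLocusBernoulliPair.bernoulliOnePrim_changeLevel hdvd, map_inv, changeLevel_primitiveCharacter]
    exact hB
  have hχω := BernoulliUnits.not_forall_norm_sub_lt_one_of_norm_bernoulliOnePrim_inv_le_one hp2 _ hprim (by
    rw [hB']; exact inv_le_one_of_one_le₀ (one_le_pow₀ (by exact_mod_cast hp.out.one_lt.le)))
  exact natCard_chiTorsion_le_of_classGroupChiCard_eq _
    (HerbrandReflectionCount.classGroupChiCard_eq_pow_of_norm_bernoulli_eq hMW hp2 hpL hprim hodd' hχω hψχ hB')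

/-! ## §2 CASE S in `p`-rank form -/

variable (W : WeierstrassCurve ℚ) [W.IsElliptic] [W.IsGloballyMinimal]

/-- **THE SELMER COUNT ON THE CLASS, CASE S, p-RANK FORM (MAZUR–WILES-FREE): `#Sel_p(W/ℚ) ≤ N²`.** `W/ℚ` globally minimal with CM,
`p ≥ 5` ramified in the CM field, `(f, ψ, ω)` a Kriz–Li character datum with `ψ` ODD, `ω` Teichmüller and the trace form `hss`; `v`
the place above `p`; CASE S (as in p676290: if a complex conjugation acts by `−1` on a stable line `Φ ≤ W[p]` of order `p` then `W` is
TRANSVERSE at `p` along `Φ`, if trivially then ALIGNED); and `hrank`: every ABELIAN realisation `(L, χ)` of `ψ` with `p ∤ [L:ℚ]`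
(`χ(τ̄) = ψ(χ_f τ)`) has `#(e_χ(ℤ_p ⊗ Cl(𝓞 L)))[p] ≤ N`. THEN `#Sel_p(W/ℚ) ≤ N²`. PROOF: the rational line `Φ = W[𝔭]`, characters
`θ_S, θ_Q` (`θ_S θ_Q = χ̄_p`) and `ψ₁`; if `ψ ~ ψ₁` then `θ_S` is odd, TRANSVERSE, `#Sel_p ≤ #R_rel(Φ.Quot)·#R_str(Φ.Sub)`, and
both factors are `≤ N` by the MW-free class side at `θ = θ_Q` (EVEN; its reflection `χ̄_p θ_Q⁻¹ = θ_S` realises `ψ`) and `θ = θ_S`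
(ODD; realises `ψ`); if `ψ ~ ψ₁⁻¹ω` then `θ_S` is even, ALIGNED, and the roles are exchanged (`θ_Q` realises `ψ`). No Bernoulli
number, no Mazur–Wiles. [cite: SilvermanAEC2009, X.§4 (Cor. 4.4, Ex. 4.8)] [cite: Washington1997, §10.2 and §6.3]
[cite: GreenbergLNM1716, §3 (PDF p. 86)] -/
theorem natCard_selmerGroup_le_sq_of_caseS_of_chiTorsion_le
    (hCM : W.HasCM) (hram : CMRamified W p) (h5 : 5 ≤ p)
    {f : ℕ} [NeZero f] (ψ : DirichletCharacter ℚ_[p] f) (ω : DirichletCharacter ℚ_[p] p)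
    (hψ : ψ.Odd) (hω : IsTeichmullerCharacter ω)
    (hss : ∀ ℓ : ℕ, ℓ.Prime → ¬ (ℓ ∣ p * W.conductorNorm ℤ) →
      ‖((W.LFunction ℓ : ℤ) : ℚ_[p]) - (ψ (ℓ : ZMod f) + ψ⁻¹ (ℓ : ZMod f) * ω (ℓ : ZMod p))‖ < 1)
    {N : ℕ}
    (hrank : ∀ (L : Type) [Field L] [NumberField L] [IsAbelianGalois ℚ L], ¬ p ∣ Module.finrank ℚ L →
      ∀ χ : (L ≃ₐ[ℚ] L) →* ℤ_[p]ˣ,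
        (∀ τ : absoluteGaloisGroup ℚ, (((χ (absGaloisQuot ℚ L τ) : ℤ_[p]ˣ) : ℤ_[p]) : ℚ_[p]) =
          ψ ((modNCyclotomicCharacter ℚ f τ : (ZMod f)ˣ) : ZMod f)) →
        Nat.card {y : ↥(classGroupChiComponent ℚ L p (fun g => ((χ g : ℤ_[p]ˣ) : ℤ_[p]))) // p • y = 0} ≤ N)
    {v : HeightOneSpectrum (𝓞 ℚ)} (hpv : ((p : ℕ) : 𝓞 ℚ) ∈ v.asIdeal)
    (hS : ∀ (Φ : StableSubgroup (absoluteGaloisGroup ℚ) (geomTorsion W (p : ℤ))), Nat.card Φ.Sub = p →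
      ∀ c : absoluteGaloisGroup ℚ, IsComplexConjugation (Rat.castHom ℝ) c →
        ((∀ x : Φ.Sub, c • x = -x) →
          ∀ w : contOneCocycles (discreteTopRep (absoluteGaloisGroup ℚ) Φ.Sub),
            oneCocycleClass (discreteTopRep (absoluteGaloisGroup ℚ) (geomTorsion W (p : ℤ)))
              (contOneCocycles.pullback (ContinuousMonoidHom.id _)
                (resHomOfEquivariant (ContinuousMonoidHom.id _) Φ.incl Φ.incl_smul) w) ∈ selmerGroup W (p : ℤ) →
              ∃ s : Φ.Sub, ∀ g ∈ decomp v, w.1 g = g • s - s) ∧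
        ((∀ x : Φ.Sub, c • x = x) →
          ∀ z : contOneCocycles (discreteTopRep (absoluteGaloisGroup ℚ) (geomTorsion W (p : ℤ))),
            oneCocycleClass _ z ∈ selmerGroup W (p : ℤ) →
              ∃ q : Φ.Quot, ∀ g ∈ decomp v, Φ.proj (z.1 g) = g • q - q)) :
    Nat.card (selmerGroup W (p : ℤ)) ≤ N ^ 2 := by
  have hpr : p.Prime := hp.out
  have hp2 : p ≠ 2 := by omega
  haveI hpne : NeZero p := ⟨hpr.ne_zero⟩
  haveI : Fact (1 < p) := ⟨hpr.one_lt⟩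
  have hωodd : ω.Odd := KrizLiBinders.teichmuller_apply_neg_one hp2 hω
  -- the rational line, its characters and avatars
  obtain ⟨Φ, θS, θQ, m, hmz, b, ψ₁, hfM, hmM, hpM, hcard, hθS, hkerS, hθQ, hkerQ, hprod, hSb, hQb, hψ₁, e⟩ :=
    exists_rationalLineData_of_hss p W hCM h5 hram ψ ω hω hss
  have hcardQ : Nat.card Φ.Quot = p := HerbrandLineRestriction.natCard_quot_eq_of_card_sub W Φ hcard
  have hcontS : ∀ x : Φ.Sub, Continuous fun g : absoluteGaloisGroup ℚ ↦ g • x :=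
    Φ.continuous_smul_sub (LevelDictionary.continuous_smul_geomTorsion W (p : ℤ))
  have hcontQ : ∀ y : Φ.Quot, Continuous fun g : absoluteGaloisGroup ℚ ↦ g • y :=
    Φ.continuous_smul_quot (LevelDictionary.continuous_smul_geomTorsion W (p : ℤ))
  have hpS : ∀ x : Φ.Sub, (p : ℤ) • x = 0 := fun x ↦ by
    rw [natCast_zsmul]; exact HerbrandLineRestriction.prime_nsmul_eq_zero_of_card_prime hcard x
  -- `θ_S = χ̄_p θ_Q⁻¹` and `θ_Q = χ̄_p θ_S⁻¹`
  have hSQ : ∀ τ : absoluteGaloisGroup ℚ, modNCyclotomicCharacter ℚ p τ * (θQ τ)⁻¹ = θS τ := fun τ ↦ by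
    rw [← hprod τ, mul_inv_cancel_right]
  have hQS : ∀ τ : absoluteGaloisGroup ℚ, modNCyclotomicCharacter ℚ p τ * (θS τ)⁻¹ = θQ τ := fun τ ↦ by
    rw [← hprod τ, mul_comm (θS τ), mul_inv_cancel_right]
  -- non-trivial action and the decomposition witnesses at `p`
  obtain ⟨𝔓₀, h𝔓₀⟩ := v.primesAbove_nonempty
  obtain ⟨g₀, -, -, c₀, hc₀, hg₀⟩ := BorelTorsion.exists_sq_mem_inertia_homothety (W := W) p hCM h5 hram hpv h𝔓₀
  have hntS : ∃ (g : absoluteGaloisGroup ℚ) (x : Φ.Sub), g • x ≠ x := by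
    haveI : Finite Φ.Sub := Nat.finite_of_card_ne_zero (by rw [hcard]; exact hpr.ne_zero)
    haveI : Nontrivial Φ.Sub := Finite.one_lt_card_iff_nontrivial.mp (by rw [hcard]; exact hpr.one_lt)
    obtain ⟨x, hx⟩ := exists_ne (0 : Φ.Sub)
    exact ⟨g₀, x, HerbrandInertiaAtP.smul_ne_sub_of_homothety W Φ hcard hc₀ hg₀ hx⟩
  have hntQ : ∃ (g : absoluteGaloisGroup ℚ) (y : Φ.Quot), g • y ≠ y := by
    haveI : Finite Φ.Quot := Nat.finite_of_card_ne_zero (by rw [hcardQ]; exact hpr.ne_zero)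
    haveI : Nontrivial Φ.Quot := Finite.one_lt_card_iff_nontrivial.mp (by rw [hcardQ]; exact hpr.one_lt)
    obtain ⟨y, hy⟩ := exists_ne (0 : Φ.Quot)
    exact ⟨g₀, y, HerbrandInertiaAtP.smul_ne_quot_of_homothety W Φ hcard hc₀ hg₀ hy⟩
  have HS : ∀ (ℓ : HeightOneSpectrum (𝓞 ℚ)), ((p : ℕ) : 𝓞 ℚ) ∈ ℓ.asIdeal → ∀ 𝔓 ∈ ℓ.primesAbove,
      ∃ g ∈ 𝔓.decompositionSubgroup (absoluteGaloisGroup ℚ), θS g ≠ modNCyclotomicCharacter ℚ p g :=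
    fun ℓ hℓ 𝔓 h𝔓 ↦ (exists_mem_decompositionSubgroup_apply_ne_cyclotomic_at_p W Φ hCM h5 hram hcard θS θQ hθS hθQ hprod
      hℓ h𝔓).1
  have HQ : ∀ (ℓ : HeightOneSpectrum (𝓞 ℚ)), ((p : ℕ) : 𝓞 ℚ) ∈ ℓ.asIdeal → ∀ 𝔓 ∈ ℓ.primesAbove,
      ∃ g ∈ 𝔓.decompositionSubgroup (absoluteGaloisGroup ℚ), θQ g ≠ modNCyclotomicCharacter ℚ p g :=
    fun ℓ hℓ 𝔓 h𝔓 ↦ (exists_mem_decompositionSubgroup_apply_ne_cyclotomic_at_p W Φ hCM h5 hram hcard θS θQ hθS hθQ hprod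
      hℓ h𝔓).2
  -- a complex conjugation and the parities of the two characters
  obtain ⟨c, hc⟩ := exists_isComplexConjugation (Rat.castHom ℝ)
  have hmc : modNCyclotomicCharacter ℚ m c = -1 :=
    Units.ext (by rw [Units.val_neg, Units.val_one]; exact modNCyclotomicCharacter_of_isComplexConjugation hc)
  have hpc : modNCyclotomicCharacter ℚ p c = -1 :=
    Units.ext (by rw [Units.val_neg, Units.val_one]; exact modNCyclotomicCharacter_of_isComplexConjugation hc)
  have hSc : θS c = b (-1) := by rw [hSb c, hmc]
  have hQc : θQ c = -1 * (b (-1))⁻¹ := by rw [hQb c, hpc, hmc]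
  have hpar := BernoulliUnits.odd_iff_of_teichmuller_lift hp2 b hψ₁
  -- the class-side local inputs at the bad places `≠ p` (w6 g3)
  have hbad' : ∀ v' : HeightOneSpectrum (𝓞 ℚ), ¬ W.HasGoodReductionAt v' → ((p : ℕ) : 𝓞 ℚ) ∉ v'.asIdeal →
      ∀ P : (W.baseChange (v'.adicCompletion ℚ)).toAffine.Point, p • P = 0 → P = 0 :=
    fun v' hg hpv' ↦ forall_prime_nsmul_eq_zero_adicCompletion_of_bad (K := ℚ) W hCM hram h5 hpv' hg
  have hQI' : ∀ v' : HeightOneSpectrum (𝓞 ℚ), ¬ W.HasGoodReductionAt v' → ((p : ℕ) : 𝓞 ℚ) ∉ v'.asIdeal →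
      ∀ 𝔓 ∈ v'.primesAbove, ∀ q : Φ.Quot,
        (∀ g ∈ 𝔓.inertia (absoluteGaloisGroup ℚ), g • q = q) → q = 0 :=
    fun v' hg hpv' 𝔓 h𝔓 q hq ↦ quot_eq_zero_of_forall_inertia_smul_eq_of_bad (K := ℚ) W Φ hCM hram h5 hpv' hg h𝔓 q hq
  rcases e with e | e
  · -- `ψ ~ ψ₁`: the SUB character `θS` is ODD and realises `ψ` — CASE S says `W` is TRANSVERSE
    have hψ₁odd : ψ₁.Odd := by
      unfold DirichletCharacter.Odd
      rw [BernoulliUnits.apply_neg_one_eq_of_changeLevel_eq hmM ψ₁ e.symm, EisensteinPair.changeLevel_apply_neg_one]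
      exact hψ
    have hb1 : b (-1) = -1 := hpar.1.mp hψ₁odd
    have hθSc : θS c = -1 := by rw [hSc, hb1]
    have hθQc : θQ c = 1 := by rw [hQc, hb1, inv_neg, inv_one, neg_mul_neg, one_mul]
    have hcx : ∀ x : Φ.Sub, c • x = -x := by
      intro x
      rw [hθS c x, hθSc, Units.val_neg, Units.val_one, ZMod.neg_val', ZMod.val_one,
        Nat.mod_eq_of_lt (Nat.sub_lt hpr.pos Nat.one_pos), Nat.cast_sub hpr.one_lt.le, Nat.cast_one, sub_smul,
        one_smul, hpS, zero_sub]
    have hTR := (hS Φ hcard c hc).1 hcx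
    -- `ψ(χ_f τ) = Teich(θ_S τ)`: every realisation of `Teich ∘ θ_S` realises `ψ`
    have havS : ∀ τ : absoluteGaloisGroup ℚ, ψ ((modNCyclotomicCharacter ℚ f τ : (ZMod f)ˣ) : ZMod f) =
        (((Kato2004.teichmullerChar p (θS τ) : ℤ_[p]ˣ) : ℤ_[p]) : ℚ_[p]) :=
      LevelDictionaryBeta.apply_modNCyclotomicCharacter_eq_teich_sub b hψ₁ θS hSb hfM hmM ψ e
    have hrankS : ∀ (L : Type) [Field L] [NumberField L] [IsAbelianGalois ℚ L], ¬ p ∣ Module.finrank ℚ L →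
        ∀ χ : (L ≃ₐ[ℚ] L) →* ℤ_[p]ˣ,
          (∀ τ : absoluteGaloisGroup ℚ, χ (absGaloisQuot ℚ L τ) = Kato2004.teichmullerChar p (θS τ)) →
          Nat.card {y : ↥(classGroupChiComponent ℚ L p (fun g => ((χ g : ℤ_[p]ˣ) : ℤ_[p]))) // p • y = 0} ≤ N :=
      fun L _ _ _ hpL χ hχ ↦ hrank L hpL χ fun τ ↦ by rw [hχ τ, havS τ]
    have hrankQ : ∀ (K : Type) [Field K] [NumberField K] [IsAbelianGalois ℚ K], ¬ p ∣ Module.finrank ℚ K →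
        ∀ χ : (K ≃ₐ[ℚ] K) →* ℤ_[p]ˣ,
          (∀ τ : absoluteGaloisGroup ℚ,
            χ (absGaloisQuot ℚ K τ) = Kato2004.teichmullerChar p (modNCyclotomicCharacter ℚ p τ * (θQ τ)⁻¹)) →
          Nat.card {y : ↥(classGroupChiComponent ℚ K p (fun g => ((χ g : ℤ_[p]ˣ) : ℤ_[p]))) // p • y = 0} ≤ N :=
      fun K _ _ _ hpK χ hχ ↦ hrank K hpK χ fun τ ↦ by rw [hχ τ, hSQ τ, havS τ]
    -- the count: quotient RELAXED (even `θ_Q`), sub STRICT (odd `θ_S`)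
    have hQ := SelmerCountClassSide.natCard_h1Unramified_le_of_chiTorsion_le hp2 hcardQ hcontQ hntQ θQ hθQ hkerQ hc hθQc HQ
      hrankQ
    have hSu := SelmerCountClassSide.natCard_strict_le_of_chiTorsion_le hp2 hcard hcontS hntS θS hθS hkerS hrankS hpv
    calc Nat.card (selmerGroup W (p : ℤ)) ≤ _ := natCard_selmerGroup_le_of_transverse W v Φ hbad' hQI' hTR
      _ ≤ N * N := Nat.mul_le_mul hQ hSu
      _ = N ^ 2 := (sq N).symm
  · -- `ψ ~ ψ₁⁻¹ω`: the SUB character `θS` is EVEN, `θ_Q` realises `ψ` — CASE S says `W` is ALIGNED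
    have hL₁ : changeLevel hmM ψ₁ = changeLevel hfM ψ⁻¹ * changeLevel hpM ω := by
      rw [map_inv, e, map_inv, mul_inv, inv_inv, inv_mul_cancel_right]
    have hψ₁even : ψ₁.Even := by
      unfold DirichletCharacter.Even
      rw [BernoulliUnits.apply_neg_one_eq_of_changeLevel_eq hmM ψ₁ hL₁, MulChar.mul_apply, map_inv,
        MulChar.inv_apply_eq_inv', EisensteinPair.changeLevel_apply_neg_one, EisensteinPair.changeLevel_apply_neg_one,
        hψ, hωodd, inv_neg, inv_one, neg_mul_neg, one_mul]
    have hb1 : b (-1) = 1 := hpar.2.mp hψ₁even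
    have hθSc : θS c = 1 := by rw [hSc, hb1]
    have hcx : ∀ x : Φ.Sub, c • x = x := by
      intro x
      rw [hθS c x, hθSc, Units.val_one, ZMod.val_one, Nat.cast_one, one_smul]
    have hAL := (hS Φ hcard c hc).2 hcx
    -- `ψ(χ_f τ) = Teich(θ_Q τ)`: every realisation of `Teich ∘ θ_Q` realises `ψ`
    have havQ : ∀ τ : absoluteGaloisGroup ℚ, ψ ((modNCyclotomicCharacter ℚ f τ : (ZMod f)ˣ) : ZMod f) =
        (((Kato2004.teichmullerChar p (θQ τ) : ℤ_[p]ˣ) : ℤ_[p]) : ℚ_[p]) :=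
      LevelDictionaryBeta.apply_modNCyclotomicCharacter_eq_teich_quot hp2 b hψ₁ hω θQ hQb hfM hmM hpM ψ e
    have hrankQ : ∀ (L : Type) [Field L] [NumberField L] [IsAbelianGalois ℚ L], ¬ p ∣ Module.finrank ℚ L →
        ∀ χ : (L ≃ₐ[ℚ] L) →* ℤ_[p]ˣ,
          (∀ τ : absoluteGaloisGroup ℚ, χ (absGaloisQuot ℚ L τ) = Kato2004.teichmullerChar p (θQ τ)) →
          Nat.card {y : ↥(classGroupChiComponent ℚ L p (fun g => ((χ g : ℤ_[p]ˣ) : ℤ_[p]))) // p • y = 0} ≤ N :=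
      fun L _ _ _ hpL χ hχ ↦ hrank L hpL χ fun τ ↦ by rw [hχ τ, havQ τ]
    have hrankS : ∀ (K : Type) [Field K] [NumberField K] [IsAbelianGalois ℚ K], ¬ p ∣ Module.finrank ℚ K →
        ∀ χ : (K ≃ₐ[ℚ] K) →* ℤ_[p]ˣ,
          (∀ τ : absoluteGaloisGroup ℚ,
            χ (absGaloisQuot ℚ K τ) = Kato2004.teichmullerChar p (modNCyclotomicCharacter ℚ p τ * (θS τ)⁻¹)) →
          Nat.card {y : ↥(classGroupChiComponent ℚ K p (fun g => ((χ g : ℤ_[p]ˣ) : ℤ_[p]))) // p • y = 0} ≤ N :=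
      fun K _ _ _ hpK χ hχ ↦ hrank K hpK χ fun τ ↦ by rw [hχ τ, hQS τ, havQ τ]
    -- the count: quotient STRICT (odd `θ_Q`), sub RELAXED (even `θ_S`)
    have hQ := SelmerCountClassSide.natCard_strict_le_of_chiTorsion_le hp2 hcardQ hcontQ hntQ θQ hθQ hkerQ hrankQ hpv
    have hSu := SelmerCountClassSide.natCard_h1Unramified_le_of_chiTorsion_le hp2 hcard hcontS hntS θS hθS hkerS hc hθSc HS
      hrankS
    calc Nat.card (selmerGroup W (p : ℤ)) ≤ _ := natCard_selmerGroup_le_of_aligned W v Φ hbad' hQI' hAL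
      _ ≤ N * N := Nat.mul_le_mul hQ hSu
      _ = N ^ 2 := (sq N).symm

/-! ## §3 The parity-split corollaries at `N = p` (CYCLIC `ψ`-components), modulo Cassels–Tate and GZK -/

/-- **On «CASE S ∧ cyclic `ψ`-components», `Ш(W)[p] = 0`** (modulo Cassels–Tate and GZK): class member with `r_an(W) = 1`, odd datum,
CASE S, `hrank p`: every element of `Ш(W/ℚ)` killed by `p` is zero (`#Sel_p ≤ p²` + w3 g8's `ParitySplit.noPTorsion_of_natCard_selmerGroup_le_sq`).
So the (β) alternative «`Ш(W)[p] ≠ 0`» (B1-sha) is EXCLUDED there for EVERY `v_p(B_{1,ψ⁻¹})`. [cite: Cassels1962ArithmeticIV]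
[cite: Washington1997, §10.2] -/
theorem sha_noPTorsion_of_caseS_of_chiTorsion_le
    (hCT : exists_casselsTate_pairing (K := ℚ)) (hGZK : rank_eq_analyticRank_of_analyticRank_le_one)
    (hCM : W.HasCM) (hram : CMRamified W p) (h5 : 5 ≤ p) (hr : W.analyticRank = 1)
    {f : ℕ} [NeZero f] (ψ : DirichletCharacter ℚ_[p] f) (ω : DirichletCharacter ℚ_[p] p)
    (hψ : ψ.Odd) (hω : IsTeichmullerCharacter ω)
    (hss : ∀ ℓ : ℕ, ℓ.Prime → ¬ (ℓ ∣ p * W.conductorNorm ℤ) →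
      ‖((W.LFunction ℓ : ℤ) : ℚ_[p]) - (ψ (ℓ : ZMod f) + ψ⁻¹ (ℓ : ZMod f) * ω (ℓ : ZMod p))‖ < 1)
    (hrank : ∀ (L : Type) [Field L] [NumberField L] [IsAbelianGalois ℚ L], ¬ p ∣ Module.finrank ℚ L →
      ∀ χ : (L ≃ₐ[ℚ] L) →* ℤ_[p]ˣ,
        (∀ τ : absoluteGaloisGroup ℚ, (((χ (absGaloisQuot ℚ L τ) : ℤ_[p]ˣ) : ℤ_[p]) : ℚ_[p]) =
          ψ ((modNCyclotomicCharacter ℚ f τ : (ZMod f)ˣ) : ZMod f)) →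
        Nat.card {y : ↥(classGroupChiComponent ℚ L p (fun g => ((χ g : ℤ_[p]ˣ) : ℤ_[p]))) // p • y = 0} ≤ p)
    {v : HeightOneSpectrum (𝓞 ℚ)} (hpv : ((p : ℕ) : 𝓞 ℚ) ∈ v.asIdeal)
    (hS : ∀ (Φ : StableSubgroup (absoluteGaloisGroup ℚ) (geomTorsion W (p : ℤ))), Nat.card Φ.Sub = p →
      ∀ c : absoluteGaloisGroup ℚ, IsComplexConjugation (Rat.castHom ℝ) c →
        ((∀ x : Φ.Sub, c • x = -x) →
          ∀ w : contOneCocycles (discreteTopRep (absoluteGaloisGroup ℚ) Φ.Sub),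
            oneCocycleClass (discreteTopRep (absoluteGaloisGroup ℚ) (geomTorsion W (p : ℤ)))
              (contOneCocycles.pullback (ContinuousMonoidHom.id _)
                (resHomOfEquivariant (ContinuousMonoidHom.id _) Φ.incl Φ.incl_smul) w) ∈ selmerGroup W (p : ℤ) →
              ∃ s : Φ.Sub, ∀ g ∈ decomp v, w.1 g = g • s - s) ∧
        ((∀ x : Φ.Sub, c • x = x) →
          ∀ z : contOneCocycles (discreteTopRep (absoluteGaloisGroup ℚ) (geomTorsion W (p : ℤ))),
            oneCocycleClass _ z ∈ selmerGroup W (p : ℤ) →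
              ∃ q : Φ.Quot, ∀ g ∈ decomp v, Φ.proj (z.1 g) = g • q - q)) :
    ∀ x : W.sha, (p : ℤ) • x = 0 → x = 0 :=
  ParitySplit.noPTorsion_of_natCard_selmerGroup_le_sq W p hCT hGZK hr
    (natCard_selmerGroup_le_sq_of_caseS_of_chiTorsion_le W hCM hram h5 ψ ω hψ hω hss hrank hpv hS)

/-- **On «CASE S ∧ cyclic `ψ`-components», `BSD(W,p) ⟺ p ∤ #Ш_an(W)`** (modulo Cassels–Tate, GZK): LEAD g11's reading «on
B1 ∩ {#Sel_p ≤ p²}, BSD_p ⟺ p ∤ #Ш_an(W)» with the Selmer condition discharged from CASE S and the `p`-RANK hypothesis `hrank p` — no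
Bernoulli number, no Mazur–Wiles (`#Sel_p ≤ p²` + w3 g8's `ParitySplit.bsdp_iff_shaAn_unit_of_natCard_selmerGroup_le_sq`).
[cite: Cassels1962ArithmeticIV] [cite: Miller2011LMS, Def. 1.1] -/
theorem bsdp_iff_shaAnUnit_of_caseS_of_chiTorsion_le
    (hCT : exists_casselsTate_pairing (K := ℚ)) (hGZK : rank_eq_analyticRank_of_analyticRank_le_one)
    (hCM : W.HasCM) (hram : CMRamified W p) (h5 : 5 ≤ p) (hr : W.analyticRank = 1)
    {f : ℕ} [NeZero f] (ψ : DirichletCharacter ℚ_[p] f) (ω : DirichletCharacter ℚ_[p] p)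
    (hψ : ψ.Odd) (hω : IsTeichmullerCharacter ω)
    (hss : ∀ ℓ : ℕ, ℓ.Prime → ¬ (ℓ ∣ p * W.conductorNorm ℤ) →
      ‖((W.LFunction ℓ : ℤ) : ℚ_[p]) - (ψ (ℓ : ZMod f) + ψ⁻¹ (ℓ : ZMod f) * ω (ℓ : ZMod p))‖ < 1)
    (hrank : ∀ (L : Type) [Field L] [NumberField L] [IsAbelianGalois ℚ L], ¬ p ∣ Module.finrank ℚ L →
      ∀ χ : (L ≃ₐ[ℚ] L) →* ℤ_[p]ˣ,
        (∀ τ : absoluteGaloisGroup ℚ, (((χ (absGaloisQuot ℚ L τ) : ℤ_[p]ˣ) : ℤ_[p]) : ℚ_[p]) =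
          ψ ((modNCyclotomicCharacter ℚ f τ : (ZMod f)ˣ) : ZMod f)) →
        Nat.card {y : ↥(classGroupChiComponent ℚ L p (fun g => ((χ g : ℤ_[p]ˣ) : ℤ_[p]))) // p • y = 0} ≤ p)
    {v : HeightOneSpectrum (𝓞 ℚ)} (hpv : ((p : ℕ) : 𝓞 ℚ) ∈ v.asIdeal)
    (hS : ∀ (Φ : StableSubgroup (absoluteGaloisGroup ℚ) (geomTorsion W (p : ℤ))), Nat.card Φ.Sub = p →
      ∀ c : absoluteGaloisGroup ℚ, IsComplexConjugation (Rat.castHom ℝ) c →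
        ((∀ x : Φ.Sub, c • x = -x) →
          ∀ w : contOneCocycles (discreteTopRep (absoluteGaloisGroup ℚ) Φ.Sub),
            oneCocycleClass (discreteTopRep (absoluteGaloisGroup ℚ) (geomTorsion W (p : ℤ)))
              (contOneCocycles.pullback (ContinuousMonoidHom.id _)
                (resHomOfEquivariant (ContinuousMonoidHom.id _) Φ.incl Φ.incl_smul) w) ∈ selmerGroup W (p : ℤ) →
              ∃ s : Φ.Sub, ∀ g ∈ decomp v, w.1 g = g • s - s) ∧
        ((∀ x : Φ.Sub, c • x = x) →
          ∀ z : contOneCocycles (discreteTopRep (absoluteGaloisGroup ℚ) (geomTorsion W (p : ℤ))),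
            oneCocycleClass _ z ∈ selmerGroup W (p : ℤ) →
              ∃ q : Φ.Quot, ∀ g ∈ decomp v, Φ.proj (z.1 g) = g • q - q)) :
    BSDp W p ↔ ∃ q : ℚ, shaAn W = (q : ℂ) ∧ padicValRat p q = 0 :=
  ParitySplit.bsdp_iff_shaAn_unit_of_natCard_selmerGroup_le_sq W p hCT hGZK hr
    (natCard_selmerGroup_le_sq_of_caseS_of_chiTorsion_le W hCM hram h5 ψ ω hψ hω hss hrank hpv hS)

/-- **B1 on «CASE S ∧ cyclic `ψ`-components» from `p ∤ #Ш_an(W)`** (modulo Cassels–Tate and GZK): with `#Ш_an(W) = q`, `padicValRat p q = 0`,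
`BSDp W p` (`#Sel_p ≤ p²` + w2 g8's `ParitySplit.bsdp_of_natCard_selmerGroup_le_sq`). [cite: Cassels1962ArithmeticIV] [cite: Miller2011LMS, Def. 1.1] -/
theorem bsdp_of_caseS_of_chiTorsion_le_of_shaAnUnit
    (hCT : exists_casselsTate_pairing (K := ℚ)) (hGZK : rank_eq_analyticRank_of_analyticRank_le_one)
    (hCM : W.HasCM) (hram : CMRamified W p) (h5 : 5 ≤ p) (hr : W.analyticRank = 1)
    {f : ℕ} [NeZero f] (ψ : DirichletCharacter ℚ_[p] f) (ω : DirichletCharacter ℚ_[p] p)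
    (hψ : ψ.Odd) (hω : IsTeichmullerCharacter ω)
    (hss : ∀ ℓ : ℕ, ℓ.Prime → ¬ (ℓ ∣ p * W.conductorNorm ℤ) →
      ‖((W.LFunction ℓ : ℤ) : ℚ_[p]) - (ψ (ℓ : ZMod f) + ψ⁻¹ (ℓ : ZMod f) * ω (ℓ : ZMod p))‖ < 1)
    (hrank : ∀ (L : Type) [Field L] [NumberField L] [IsAbelianGalois ℚ L], ¬ p ∣ Module.finrank ℚ L →
      ∀ χ : (L ≃ₐ[ℚ] L) →* ℤ_[p]ˣ,
        (∀ τ : absoluteGaloisGroup ℚ, (((χ (absGaloisQuot ℚ L τ) : ℤ_[p]ˣ) : ℤ_[p]) : ℚ_[p]) =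
          ψ ((modNCyclotomicCharacter ℚ f τ : (ZMod f)ˣ) : ZMod f)) →
        Nat.card {y : ↥(classGroupChiComponent ℚ L p (fun g => ((χ g : ℤ_[p]ˣ) : ℤ_[p]))) // p • y = 0} ≤ p)
    {q : ℚ} (hq : shaAn W = (q : ℂ)) (hvq : padicValRat p q = 0)
    {v : HeightOneSpectrum (𝓞 ℚ)} (hpv : ((p : ℕ) : 𝓞 ℚ) ∈ v.asIdeal)
    (hS : ∀ (Φ : StableSubgroup (absoluteGaloisGroup ℚ) (geomTorsion W (p : ℤ))), Nat.card Φ.Sub = p →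
      ∀ c : absoluteGaloisGroup ℚ, IsComplexConjugation (Rat.castHom ℝ) c →
        ((∀ x : Φ.Sub, c • x = -x) →
          ∀ w : contOneCocycles (discreteTopRep (absoluteGaloisGroup ℚ) Φ.Sub),
            oneCocycleClass (discreteTopRep (absoluteGaloisGroup ℚ) (geomTorsion W (p : ℤ)))
              (contOneCocycles.pullback (ContinuousMonoidHom.id _)
                (resHomOfEquivariant (ContinuousMonoidHom.id _) Φ.incl Φ.incl_smul) w) ∈ selmerGroup W (p : ℤ) →
              ∃ s : Φ.Sub, ∀ g ∈ decomp v, w.1 g = g • s - s) ∧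
        ((∀ x : Φ.Sub, c • x = x) →
          ∀ z : contOneCocycles (discreteTopRep (absoluteGaloisGroup ℚ) (geomTorsion W (p : ℤ))),
            oneCocycleClass _ z ∈ selmerGroup W (p : ℤ) →
              ∃ q : Φ.Quot, ∀ g ∈ decomp v, Φ.proj (z.1 g) = g • q - q)) :
    BSDp W p :=
  ParitySplit.bsdp_of_natCard_selmerGroup_le_sq W p hCT hGZK hr hq hvq
    (natCard_selmerGroup_le_sq_of_caseS_of_chiTorsion_le W hCM hram h5 ψ ω hψ hω hss hrank hpv hS)

/-- **LEAD g11's «B1-sha» is VACUOUS on «CASE S ∧ cyclic `ψ`-components»** (modulo `hCT`, `hGZK`): the premise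
`∃ s ∈ W.sha, s ≠ 0 ∧ p • s = 0` contradicts `sha_noPTorsion_of_caseS_of_chiTorsion_le`, so `BSDp W p` follows trivially — only B1-level
(the invisible generator, there `⟺ p ∤ #Ш_an(W)`) carries content on this branch, for every `v_p(B_{1,ψ⁻¹})`. [cite: Cassels1962ArithmeticIV] -/
theorem bsdp_of_sha_ne_zero_of_caseS_of_chiTorsion_le
    (hCT : exists_casselsTate_pairing (K := ℚ)) (hGZK : rank_eq_analyticRank_of_analyticRank_le_one)
    (hCM : W.HasCM) (hram : CMRamified W p) (h5 : 5 ≤ p) (hr : W.analyticRank = 1)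
    {f : ℕ} [NeZero f] (ψ : DirichletCharacter ℚ_[p] f) (ω : DirichletCharacter ℚ_[p] p)
    (hψ : ψ.Odd) (hω : IsTeichmullerCharacter ω)
    (hss : ∀ ℓ : ℕ, ℓ.Prime → ¬ (ℓ ∣ p * W.conductorNorm ℤ) →
      ‖((W.LFunction ℓ : ℤ) : ℚ_[p]) - (ψ (ℓ : ZMod f) + ψ⁻¹ (ℓ : ZMod f) * ω (ℓ : ZMod p))‖ < 1)
    (hrank : ∀ (L : Type) [Field L] [NumberField L] [IsAbelianGalois ℚ L], ¬ p ∣ Module.finrank ℚ L →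
      ∀ χ : (L ≃ₐ[ℚ] L) →* ℤ_[p]ˣ,
        (∀ τ : absoluteGaloisGroup ℚ, (((χ (absGaloisQuot ℚ L τ) : ℤ_[p]ˣ) : ℤ_[p]) : ℚ_[p]) =
          ψ ((modNCyclotomicCharacter ℚ f τ : (ZMod f)ˣ) : ZMod f)) →
        Nat.card {y : ↥(classGroupChiComponent ℚ L p (fun g => ((χ g : ℤ_[p]ˣ) : ℤ_[p]))) // p • y = 0} ≤ p)
    {v : HeightOneSpectrum (𝓞 ℚ)} (hpv : ((p : ℕ) : 𝓞 ℚ) ∈ v.asIdeal)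
    (hS : ∀ (Φ : StableSubgroup (absoluteGaloisGroup ℚ) (geomTorsion W (p : ℤ))), Nat.card Φ.Sub = p →
      ∀ c : absoluteGaloisGroup ℚ, IsComplexConjugation (Rat.castHom ℝ) c →
        ((∀ x : Φ.Sub, c • x = -x) →
          ∀ w : contOneCocycles (discreteTopRep (absoluteGaloisGroup ℚ) Φ.Sub),
            oneCocycleClass (discreteTopRep (absoluteGaloisGroup ℚ) (geomTorsion W (p : ℤ)))
              (contOneCocycles.pullback (ContinuousMonoidHom.id _)
                (resHomOfEquivariant (ContinuousMonoidHom.id _) Φ.incl Φ.incl_smul) w) ∈ selmerGroup W (p : ℤ) →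
              ∃ s : Φ.Sub, ∀ g ∈ decomp v, w.1 g = g • s - s) ∧
        ((∀ x : Φ.Sub, c • x = x) →
          ∀ z : contOneCocycles (discreteTopRep (absoluteGaloisGroup ℚ) (geomTorsion W (p : ℤ))),
            oneCocycleClass _ z ∈ selmerGroup W (p : ℤ) →
              ∃ q : Φ.Quot, ∀ g ∈ decomp v, Φ.proj (z.1 g) = g • q - q))
    (hsha : ∃ s ∈ W.sha, s ≠ 0 ∧ p • s = 0) : BSDp W p := by
  exfalso
  obtain ⟨s, hs, hs0, hps⟩ := hsha
  have h := sha_noPTorsion_of_caseS_of_chiTorsion_le W hCT hGZK hCM hram h5 hr ψ ω hψ hω hss hrank hpv hS ⟨s, hs⟩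
    (Subtype.ext (by rw [AddSubgroupClass.coe_zsmul, ZeroMemClass.coe_zero, natCast_zsmul]; exact hps))
  exact hs0 (congrArg Subtype.val h)

end Summit.BirchSwinnertonDyer.BirchSwinnertonDyer.Theorems.PrintCFram.SelmerCount

end
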